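import Summits.KontsevichZagierPeriods.KontsevichZagierPeriods.Theses.RootDecompPureDefect

/-!
# Route RootDecompPureDefect (E″) — glue item 31139 `PiConnectedGlue` PROVED BY NAME

The gen-8 split of the residual `PiConnected` (item 27509, `K_ϖ`: no value-0 quasi-idempotent in `P[1/ϖ]`) by the
arithmetic nature of `ϖ = ⟦π⟧` on phantom sheets (decomp-kz lens-5 g8, critic CLEARED 2026-08-30T08:31:34Z; route rev 3
commit 528d2d79580d): `PolyPiCancellation` (31137: a phantom sheet killed by a NON-ZERO integer polynomial in `ϖ` is
`ϖ`-power torsion) ∧ `PhantomPiAlgebraic` (31138: every value-0 phantom sheet is killed by some non-zero integer polynomial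
in `ϖ`) ⟹ `PiConnected`. Pure logic: B produces the polynomial, A turns it into `ϖ`-power torsion (the writer's by-name
re-proof `e8/PiConnectedGlueProof.lean`, farm rc 0, evidence #1 on the item; landed by the census seat decomp-kz-census-1 g6).
Standard axioms, 0 sorry.
-/

namespace Summit.KontsevichZagierPeriods.RootDecompPureDefect

open Summit.KontsevichZagierPeriods.KontsevichZagierPeriods.Theses.RootDecompPureDefect

/-- **Glue item 31139** `PiConnectedGlue : PolyPiCancellation → PhantomPiAlgebraic → PiConnected` holds: given a phantom
sheet `f` (`f² = ϖᵏ·f`) of value `0`, `PhantomPiAlgebraic` yields a non-zero `u ∈ ℤ[X]` with `u(ϖ)·f = 0`, and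
`PolyPiCancellation` converts this into `ϖᵐ·f = 0`. -/
theorem piConnectedGlue_proof : PiConnectedGlue := by
  intro hA hB f hk hf
  obtain ⟨k, hk⟩ := hk
  obtain ⟨u, hu, huf⟩ := hB f k hk hf
  exact hA f k u hk hu huf

/-- The edge recorded by the split: `PiConnected` is implied by the two children (restatement of the glue as an
implication between the born decls, for by-name citation). -/
theorem piConnected_of_sheets (hA : PolyPiCancellation) (hB : PhantomPiAlgebraic) : PiConnected :=
  piConnectedGlue_proof hA hB

end Summit.KontsevichZagierPeriods.RootDecompPureDefect
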